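import Summits.AnomalousDissipation.AnomalousDissipation.Theorems.MarginalStabilityChainBurgersLayerKHLine
import Summits.AnomalousDissipation.AnomalousDissipation.Theorems.MarginalStabilityChainBurgersLayerKHStubResolventA
import Summits.AnomalousDissipation.AnomalousDissipation.Theorems.MarginalStabilityChainBurgersLayerKHStubResolventB

/-! # Stub `stub_resolventExists` of the line `Sketch`
(crux stmt-AnomalousDissipation-3008, `MarginalStabilityChain.BurgersLayerKH`)

**The Gaussian-class resolvent of `λ + iU − h·OU` with the `h`-UNIFORM constant `K = 4`.**
For `α ∈ (0, 1]`, `re λ > 0`, `0 < h ≤ re λ` and continuous `F` with `‖F y‖ ≤ C e^{−y²/4}`, the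
resolvent equation `(λ + iU) ω − h (ω'' + y ω' + (1 − α²) ω) = F` has a `C²` solution with
`‖ω y‖ ≤ (4C/re λ) e^{−y²/4}`.

Proof. In the Weber variable `W = e^{y²/4} ω` (`ou_gauss_mul`:
`ou α (e^{−y²/4} W) = e^{−y²/4} (W'' − (y²/4 + α² − ½) W)`) the equation is `W'' = Q W − g` with
`Q = (λ + iU)/h + y²/4 + α² − ½`, `g = e^{y²/4} F / h`, `re Q ≥ re λ/h − ½ ≥ γ² := re λ/(2h)` and
`‖g‖ ≤ C/h`. Helper A (`resolvent_dichotomy`) gives the whole-line exponential dichotomy of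
`W'' = Q W` (rate `√2γ/2`, product bound `1/(√2γ)`), helper B (`green_bounded`) the bounded solution
`‖W‖ ≤ 2 (C/h) (1/(√2γ)) / (√2γ/2) = 2C/(hγ²) = 4C/re λ`; finally `ω := e^{−y²/4} W`.
-/

set_option linter.dupNamespace false

noncomputable section

open Complex MeasureTheory Filter Topology Set Metric

namespace Summit.AnomalousDissipation.AnomalousDissipation.Theorems.BurgersLayerKH.Sheet.Resolvent

open Literature.Analysis.ODE

/-! ## The Gaussian conjugation `ω = e^{−y²/4} W` -/

/-- `φ(y) = e^{−y²/4}` (complex-valued) has `φ' = −(y/2) φ`. [folklore] -/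
theorem hasDerivAt_gauss (y : ℝ) :
    HasDerivAt (fun x : ℝ => (Real.exp (-(x ^ 2) / 4) : ℂ))
      (-(y : ℂ) / 2 * (Real.exp (-(y ^ 2) / 4) : ℂ)) y := by
  have h1 : HasDerivAt (fun x : ℝ => Real.exp (-(x ^ 2) / 4))
      (Real.exp (-(y ^ 2) / 4) * (-(2 * y) / 4)) y := by
    have := (((hasDerivAt_pow 2 y).neg).div_const 4).exp
    refine this.congr_deriv ?_
    simp
  refine h1.ofReal_comp.congr_deriv ?_
  push_cast
  ring

/-- **Gaussian conjugation.** If `W` is twice differentiable with `W' = W₁`, `W₁' = W₂` and `W₂`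
continuous, then `ω = e^{−y²/4} W` is `C²` and
`ou α ω = ω'' + y ω' + (1 − α²) ω = e^{−y²/4} (W₂ − (y²/4 + α² − ½) W)`. [folklore] -/
theorem ou_gauss_mul {W W₁ W₂ : ℝ → ℂ} (hW : ∀ y, HasDerivAt W (W₁ y) y)
    (hW₁ : ∀ y, HasDerivAt W₁ (W₂ y) y) (hW₂ : Continuous W₂) (α : ℝ) :
    ContDiff ℝ 2 (fun x => (Real.exp (-(x ^ 2) / 4) : ℂ) * W x) ∧
      ∀ y : ℝ, ou α (fun x => (Real.exp (-(x ^ 2) / 4) : ℂ) * W x) y =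
        (Real.exp (-(y ^ 2) / 4) : ℂ) * (W₂ y - ((y ^ 2 / 4 + α ^ 2 - 1 / 2 : ℝ) : ℂ) * W y) := by
  have cW : Continuous W := continuous_iff_continuousAt.2 fun x => (hW x).continuousAt
  have cW₁ : Continuous W₁ := continuous_iff_continuousAt.2 fun x => (hW₁ x).continuousAt
  set ω₁ : ℝ → ℂ := fun x => (Real.exp (-(x ^ 2) / 4) : ℂ) * (W₁ x - (x : ℂ) / 2 * W x) with hω₁
  set ω₂ : ℝ → ℂ := fun x => (Real.exp (-(x ^ 2) / 4) : ℂ) *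
    (W₂ x - (x : ℂ) * W₁ x - W x / 2 + (x : ℂ) ^ 2 / 4 * W x) with hω₂
  have hωd : ∀ x, HasDerivAt (fun x => (Real.exp (-(x ^ 2) / 4) : ℂ) * W x) (ω₁ x) x := fun x => by
    simp only [hω₁]
    exact ((hasDerivAt_gauss x).mul (hW x)).congr_deriv (by ring)
  have hd1 : deriv (fun x => (Real.exp (-(x ^ 2) / 4) : ℂ) * W x) = ω₁ :=
    funext fun x => (hωd x).deriv
  have hlin : ∀ x : ℝ, HasDerivAt (fun x : ℝ => (x : ℂ) / 2 * W x)
      (1 / 2 * W x + (x : ℂ) / 2 * W₁ x) x := fun x => by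
    have h1 : HasDerivAt (fun x : ℝ => (x : ℂ) / 2) (1 / 2) x := by
      simpa using ((hasDerivAt_id x).ofReal_comp).div_const (2 : ℂ)
    exact (h1.mul (hW x)).congr_deriv (by ring)
  have hω₁d : ∀ x, HasDerivAt ω₁ (ω₂ x) x := fun x => by
    simp only [hω₁, hω₂]
    exact ((hasDerivAt_gauss x).mul ((hW₁ x).sub (hlin x))).congr_deriv
      (by simp only [Pi.sub_apply]; ring)
  have hd2 : deriv ω₁ = ω₂ := funext fun x => (hω₁d x).deriv
  refine ⟨?_, fun y => ?_⟩
  · rw [show (2 : WithTop ℕ∞) = 1 + 1 by norm_num, contDiff_succ_iff_deriv, hd1,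
      show (1 : WithTop ℕ∞) = 0 + 1 by norm_num, contDiff_succ_iff_deriv, hd2, contDiff_zero]
    refine ⟨fun x => (hωd x).differentiableAt, by simp, fun x => (hω₁d x).differentiableAt,
      by simp, ?_⟩
    simp only [hω₂]
    fun_prop
  · unfold ou
    rw [iteratedDeriv_succ, iteratedDeriv_one, hd1, hd2]
    simp only [hω₁, hω₂]
    push_cast
    ring

/-! ## The stub -/

/-- **Gaussian-class resolvent of `λ + iU − h·OU` with the `h`-uniform constant `K = 4`**
(registered stub `stub_resolventExists` of the line `Sketch`): for `α ∈ (0,1]`, `re λ > 0`,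
`0 < h ≤ re λ` and continuous `F` with `‖F‖ ≤ C e^{−y²/4}`, the resolvent equation
`(λ + iU) ω − h (ω'' + y ω' + (1 − α²) ω) = F` has a `C²` Gaussian-class solution with
`‖ω y‖ ≤ (4 C / re λ) e^{−y²/4}` (Green's function of the two recessive Weber solutions in the
variable `W = e^{y²/4} ω`). [folklore] -/
theorem stub_resolventExists : ∃ K : ℝ, ResolventBound K := by
  refine ⟨4, fun α _hα _hα1 lam hlam h hh hhle F hF C hFC => ?_⟩
  -- the Weber coefficient and forcing
  set Q : ℝ → ℂ := fun y => (lam + I * (U y : ℂ)) / (h : ℂ) +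
    ((y ^ 2 / 4 + α ^ 2 - 1 / 2 : ℝ) : ℂ) with hQ
  set g : ℝ → ℂ := fun y => (Real.exp (y ^ 2 / 4) : ℂ) * F y / (h : ℂ) with hg
  set γ : ℝ := Real.sqrt (lam.re / (2 * h)) with hγ
  have hγ0 : 0 < γ := Real.sqrt_pos.2 (by positivity)
  have hγ2 : γ ^ 2 = lam.re / (2 * h) := Real.sq_sqrt (by positivity)
  have hU : Continuous U := by
    unfold U
    exact intervalIntegral.continuous_primitive
      (fun a b => (by fun_prop : Continuous fun s : ℝ => Real.exp (-(s ^ 2) / 2)).intervalIntegrable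
        a b) 0
  have hQc : Continuous Q := by
    simp only [hQ]
    fun_prop
  have hgc : Continuous g := by
    simp only [hg]
    fun_prop
  have hQre : ∀ y, γ ^ 2 ≤ (Q y).re := fun y => by
    have e : (Q y).re = lam.re / h + (y ^ 2 / 4 + α ^ 2 - 1 / 2) := by
      simp only [hQ, Complex.add_re, Complex.div_ofReal_re, Complex.mul_re, Complex.I_re,
        Complex.I_im, Complex.ofReal_re, Complex.ofReal_im]
      ring
    rw [e, hγ2]
    have h1 : 1 / 2 ≤ lam.re / (2 * h) := by
      rw [le_div_iff₀ (by positivity)]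
      linarith
    have h2 : lam.re / h = 2 * (lam.re / (2 * h)) := by
      field_simp
    rw [h2]
    nlinarith [sq_nonneg y, sq_nonneg α]
  have hgb : ∀ y, ‖g y‖ ≤ C / h := fun y => by
    simp only [hg]
    rw [norm_div, norm_mul, Complex.norm_real, Complex.norm_real, Real.norm_eq_abs,
      Real.norm_eq_abs, abs_of_pos (Real.exp_pos _), abs_of_pos hh]
    refine div_le_div_of_nonneg_right ?_ hh.le
    have hee : Real.exp (y ^ 2 / 4) * Real.exp (-(y ^ 2) / 4) = 1 := by
      rw [← Real.exp_add, show y ^ 2 / 4 + -(y ^ 2) / 4 = 0 by ring, Real.exp_zero]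
    calc Real.exp (y ^ 2 / 4) * ‖F y‖ ≤ Real.exp (y ^ 2 / 4) * (C * Real.exp (-(y ^ 2) / 4)) :=
          mul_le_mul_of_nonneg_left (hFC y) (Real.exp_pos _).le
      _ = C := by linear_combination C * hee
  -- the dichotomy (helper A) and Green's formula (helper B)
  obtain ⟨Wp, Wp', Wm, Wm', hp, hm, hW, hdp, hdm, hP⟩ := resolvent_dichotomy Q γ hQc hγ0 hQre
  have hκ : 0 < Real.sqrt 2 * γ / 2 := by positivity
  obtain ⟨W, W', hWd, hW'd, hWb⟩ := green_bounded Q g Wp Wp' Wm Wm' (Real.sqrt 2 * γ / 2)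
    (1 / (Real.sqrt 2 * γ)) (C / h) hgc hκ hgb hp hm hW hdp hdm hP
  -- back to `ω = e^{-y²/4} W`
  have hW₂c : Continuous fun y => Q y * W y - g y := by
    have cW : Continuous W := continuous_iff_continuousAt.2 fun x => (hWd x).continuousAt
    fun_prop
  have hreg := ou_gauss_mul hWd hW'd hW₂c α
  have hK : 2 * (C / h) * (1 / (Real.sqrt 2 * γ)) / (Real.sqrt 2 * γ / 2) = 4 * C / lam.re := by
    have hlam : lam.re = 2 * h * γ ^ 2 := by
      rw [hγ2]
      field_simp
    have h2 : Real.sqrt 2 ^ 2 = 2 := Real.sq_sqrt zero_le_two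
    rw [hlam]
    field_simp
    rw [h2]
    ring
  have hGω : GaussBound (fun x => (Real.exp (-(x ^ 2) / 4) : ℂ) * W x) (4 * C / lam.re) := by
    intro y
    rw [norm_mul, Complex.norm_real, Real.norm_eq_abs, abs_of_pos (Real.exp_pos _), ← hK,
      mul_comm]
    exact mul_le_mul_of_nonneg_right (hWb y) (Real.exp_pos _).le
  have heq : ∀ y : ℝ, (lam + I * (U y : ℂ)) * ((Real.exp (-(y ^ 2) / 4) : ℂ) * W y) -
      (h : ℂ) * ou α (fun x => (Real.exp (-(x ^ 2) / 4) : ℂ) * W x) y = F y := by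
    intro y
    rw [hreg.2 y]
    have hh0 : (h : ℂ) ≠ 0 := Complex.ofReal_ne_zero.2 hh.ne'
    have e1 : (h : ℂ) * Q y = lam + I * (U y : ℂ) + (h : ℂ) * ((y ^ 2 / 4 + α ^ 2 - 1 / 2 : ℝ) : ℂ) := by
      simp only [hQ]
      rw [mul_add, mul_div_cancel₀ _ hh0]
    have hφ1 : (Real.exp (-(y ^ 2) / 4) : ℂ) * (Real.exp (y ^ 2 / 4) : ℂ) = 1 := by
      rw [← Complex.ofReal_mul, ← Real.exp_add, show -(y ^ 2) / 4 + y ^ 2 / 4 = 0 by ring,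
        Real.exp_zero, Complex.ofReal_one]
    have e2 : (h : ℂ) * ((Real.exp (-(y ^ 2) / 4) : ℂ) * g y) = F y := by
      simp only [hg]
      rw [mul_div_assoc', mul_div_cancel₀ _ hh0] at *
      linear_combination (F y) * hφ1
    linear_combination (-((Real.exp (-(y ^ 2) / 4) : ℂ) * W y)) * e1 + e2
  exact ⟨fun x => (Real.exp (-(x ^ 2) / 4) : ℂ) * W x, ⟨hreg.1, ⟨_, hGω⟩, heq⟩, hGω⟩

end Summit.AnomalousDissipation.AnomalousDissipation.Theorems.BurgersLayerKH.Sheet.Resolvent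

end
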